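import Mathlib
import HarnessLib
import Summits.Ventures.LatticeQCDFlow.Scoring.AcceptanceMonitorBatch
import Summits.Ventures.LatticeQCDFlow.Scaling.AcceptanceJensenFloor

/-!
# LatticeQCDFlow / Scoring — the Jensen floor ON THE BATCH: on every positive batch of `n ≥ 2`
# proposals the printed monitors obey `acc_est ≥ (n·exp(−D̂ − Γ̂/2) − 1)/(n − 1)` identically

HONEST FRAMING: exact (Metropolis-corrected) sampling algorithms for lattice gauge theory;
figures of merit are autocorrelation/cost numbers at stated couplings and volumes; no
continuum-physics claim.

Venture `LatticeQCDFlow` (cell pub-lqcd), sub-topic `Scoring`; FANOUT row 3 (`s0-u1-a`, S0-B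
implementation A, GEN-11).  NEW WORK of the cell (one Jensen step on a finite batch), not a published
result; NO definition is introduced.  The batch companion of row 3's population law
`Scaling/AcceptanceJensenFloor` (`acc ≥ exp(−D(q‖p) − ½E|log w − log w′|)`, imported for
`log_min_eq_half`), in the vocabulary of row 3's `Scoring/AcceptanceMonitorBatch` (GEN-6, imported;
`sum_erase_min_eq`): ONE fresh batch of `n` i.i.d. proposals with un-normalised weights
`W_1 … W_n > 0`, `ℓ_i = log W_i`, and the trainer's printed monitor
`acc_est = Σ_{i≠j} min(W_i, W_j)/((n − 1)ΣW)`.  Two further batch statistics, both standard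
checkpoint columns: the batch reverse-KL estimate `D̂ = log W̄ − (1/n)Σ ℓ_i` (log of the mean weight
minus the mean log-weight; `≥ 0` by AM–GM, `batchKL_nonneg`; the unknown `log Z` cancels) and the
batch Gini mean difference of the log-weights `Γ̂ = Σ_{i,j}|ℓ_i − ℓ_j|/n²`.

* `batchKL_nonneg` — `(1/n)Σ log W_i ≤ log((1/n)Σ W_i)`;
* **`exp_jensen_le_plugIn`** — `exp((1/n)Σ ℓ_i − Γ̂/2) ≤ Σ_{i,j} min(W_i, W_j)/n²` (Jensen for `log`
  over the `n²` ordered pairs, `log min(W_i, W_j) = (ℓ_i + ℓ_j)/2 − |ℓ_i − ℓ_j|/2`);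
* **`jensen_le_accMonitor`** — `acc_est ≥ (n·exp(−D̂ − Γ̂/2) − 1)/(n − 1)` on every positive batch of
  size `n ≥ 2` (remove the diagonal: `Σ_{i≠j} min = Σ_{i,j} min − ΣW`).

Reading (value-free): a third IDENTICALLY-TRUE relation among printed checkpoint columns, next to
GEN-6's `acc_est ≥ (n·ess/2 − 1)/(n − 1)` and GEN-8's `acc_est ≥ ((8/9)·n·ess − 1)/(n − 1)`: the
acceptance monitor, the batch KL estimate and the log-weight spread of ONE batch must satisfy
`acc_est ≥ (n·e^{−D̂ − Γ̂/2} − 1)/(n − 1)`; a violating line is an implementation defect, not a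
fluctuation.  NOT CLAIMED: any sampling statement; any monitor value of ours; nothing re-scored.
-/

namespace Summit.Ventures.LatticeQCDFlow.Scoring

open Finset
open Summit.Ventures.LatticeQCDFlow.Theory2

section Batch

variable {ι : Type*} [Fintype ι]

/-- **`D̂ ≥ 0`**: the mean log-weight is at most the log of the mean weight (Jensen / AM–GM).
[folklore] -/
theorem batchKL_nonneg [Nonempty ι] {W : ι → ℝ} (hW : ∀ i, 0 < W i) :
    (∑ i, Real.log (W i)) / Fintype.card ι ≤ Real.log ((∑ i, W i) / Fintype.card ι) := by
  have hn : 0 < (Fintype.card ι : ℝ) := Nat.cast_pos.2 Fintype.card_pos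
  have hJ := (strictConcaveOn_log_Ioi.concaveOn).le_map_sum (t := (univ : Finset ι))
    (w := fun _ => ((Fintype.card ι : ℝ))⁻¹) (p := W) (fun _ _ => (inv_pos.2 hn).le)
    (sum_uniform_eq_one) (fun i _ => Set.mem_Ioi.mpr (hW i))
  simp only [smul_eq_mul] at hJ
  rw [← mul_sum, ← mul_sum] at hJ
  rw [div_eq_inv_mul, div_eq_inv_mul]
  exact hJ

/-- **Jensen on the batch pairs**: `exp((1/n)Σ log W_i − Σ_{i,j}|log W_i − log W_j|/(2n²))
≤ Σ_{i,j} min(W_i, W_j)/n²` for every positive batch. [ours] -/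
theorem exp_jensen_le_plugIn [Nonempty ι] {W : ι → ℝ} (hW : ∀ i, 0 < W i) :
    Real.exp ((∑ i, Real.log (W i)) / Fintype.card ι
        - (∑ i, ∑ j, |Real.log (W i) - Real.log (W j)|) / (2 * (Fintype.card ι : ℝ) ^ 2))
      ≤ (∑ i, ∑ j, min (W i) (W j)) / (Fintype.card ι : ℝ) ^ 2 := by
  classical
  set n : ℝ := (Fintype.card ι : ℝ) with hndef
  have hn : 0 < n := Nat.cast_pos.2 Fintype.card_pos
  have hn2 : 0 < n ^ 2 := pow_pos hn 2
  -- Jensen for `log` over the `n²` ordered pairs with equal weights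
  have hw1 : ∑ _z : ι × ι, ((n ^ 2)⁻¹ : ℝ) = 1 := by
    rw [sum_const, card_univ, Fintype.card_prod, nsmul_eq_mul, Nat.cast_mul, ← hndef, ← sq,
      mul_inv_cancel₀ hn2.ne']
  have hJ := (strictConcaveOn_log_Ioi.concaveOn).le_map_sum (t := (univ : Finset (ι × ι)))
    (w := fun _ => ((n ^ 2)⁻¹ : ℝ)) (p := fun z => min (W z.1) (W z.2))
    (fun _ _ => (inv_pos.2 hn2).le) hw1 (fun z _ => Set.mem_Ioi.mpr (lt_min (hW z.1) (hW z.2)))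
  simp only [smul_eq_mul] at hJ
  rw [← mul_sum, ← mul_sum] at hJ
  -- the right side is the plug-in
  have hR : (n ^ 2)⁻¹ * ∑ z : ι × ι, min (W z.1) (W z.2) = (∑ i, ∑ j, min (W i) (W j)) / n ^ 2 := by
    rw [Fintype.sum_prod_type, inv_mul_eq_div]
  -- the left side is `mean ℓ − Γ̂/2`
  have hL : (n ^ 2)⁻¹ * ∑ z : ι × ι, Real.log (min (W z.1) (W z.2))
      = (∑ i, Real.log (W i)) / n - (∑ i, ∑ j, |Real.log (W i) - Real.log (W j)|) / (2 * n ^ 2) := by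
    have e : ∀ z : ι × ι, Real.log (min (W z.1) (W z.2))
        = Real.log (W z.1) / 2 + Real.log (W z.2) / 2
          - |Real.log (W z.1) - Real.log (W z.2)| / 2 := fun z => by
      rw [log_min_eq_half (hW z.1) (hW z.2)]; ring
    simp_rw [e]
    rw [sum_sub_distrib, sum_add_distrib, ← sum_div, ← sum_div, ← sum_div]
    have S1 : ∑ z : ι × ι, Real.log (W z.1) = n * ∑ i, Real.log (W i) := by
      rw [Fintype.sum_prod_type]
      simp only [sum_const, card_univ, nsmul_eq_mul]
      rw [← hndef, mul_sum]
    have S2 : ∑ z : ι × ι, Real.log (W z.2) = n * ∑ i, Real.log (W i) := by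
      rw [Fintype.sum_prod_type_right]
      simp only [sum_const, card_univ, nsmul_eq_mul]
      rw [← hndef, mul_sum]
    have S3 : ∑ z : ι × ι, |Real.log (W z.1) - Real.log (W z.2)|
        = ∑ i, ∑ j, |Real.log (W i) - Real.log (W j)| := by
      rw [Fintype.sum_prod_type]
    rw [S1, S2, S3]
    field_simp
    ring
  rw [hR, hL] at hJ
  have hpos : 0 < (∑ i, ∑ j, min (W i) (W j)) / n ^ 2 :=
    div_pos (sum_pos (fun i _ => sum_pos (fun j _ => lt_min (hW i) (hW j)) univ_nonempty)
      univ_nonempty) hn2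
  exact (Real.le_log_iff_exp_le hpos).mp hJ

/-- **THE BATCH JENSEN LAW.**  On every positive batch of `n ≥ 2` proposals the printed acceptance
monitor satisfies `acc_est ≥ (n·exp(−D̂ − Γ̂/2) − 1)/(n − 1)` with `D̂ = log W̄ − (1/n)Σ log W_i` and
`Γ̂ = Σ_{i,j}|log W_i − log W_j|/n²`, identically. [ours] -/
theorem jensen_le_accMonitor [DecidableEq ι] {W : ι → ℝ} (hW : ∀ i, 0 < W i)
    (hn : 2 ≤ Fintype.card ι) :
    ((Fintype.card ι : ℝ) * Real.exp (-(Real.log ((∑ i, W i) / Fintype.card ι)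
          - (∑ i, Real.log (W i)) / Fintype.card ι)
        - (∑ i, ∑ j, |Real.log (W i) - Real.log (W j)|) / (2 * (Fintype.card ι : ℝ) ^ 2)) - 1)
        / (Fintype.card ι - 1)
      ≤ (∑ i, ∑ j ∈ univ.erase i, min (W i) (W j)) / ((Fintype.card ι - 1) * ∑ i, W i) := by
  haveI : Nonempty ι := Fintype.card_pos_iff.mp (by omega)
  set n : ℝ := (Fintype.card ι : ℝ) with hndef
  have h2 : (2 : ℝ) ≤ n := by rw [hndef]; exact_mod_cast hn
  have hn : 0 < n := by linarith
  have hn1 : 0 < n - 1 := by linarith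
  have hS : 0 < ∑ i, W i := sum_pos (fun i _ => hW i) univ_nonempty
  have hWbar : 0 < (∑ i, W i) / n := div_pos hS hn
  -- `exp(−D̂ − Γ̂/2) = exp(mean ℓ − Γ̂/2) / W̄`
  have hexp : Real.exp (-(Real.log ((∑ i, W i) / n) - (∑ i, Real.log (W i)) / n)
        - (∑ i, ∑ j, |Real.log (W i) - Real.log (W j)|) / (2 * n ^ 2))
      = Real.exp ((∑ i, Real.log (W i)) / n
          - (∑ i, ∑ j, |Real.log (W i) - Real.log (W j)|) / (2 * n ^ 2)) / ((∑ i, W i) / n) := by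
    rw [eq_div_iff hWbar.ne', ← Real.exp_log hWbar, ← Real.exp_add, Real.exp_log hWbar]
    congr 1
    ring
  have hJ := exp_jensen_le_plugIn hW
  rw [← hndef] at hJ
  rw [hexp, sum_erase_min_eq, div_le_div_iff₀ hn1 (mul_pos hn1 hS)]
  -- `(n·E/W̄ − 1)·((n−1)·ΣW) ≤ (ΣΣmin − ΣW)·(n−1)` where `E ≤ ΣΣmin/n²`
  have hkey : n * (Real.exp ((∑ i, Real.log (W i)) / n
      - (∑ i, ∑ j, |Real.log (W i) - Real.log (W j)|) / (2 * n ^ 2)) / ((∑ i, W i) / n))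
        * ∑ i, W i ≤ ∑ i, ∑ j, min (W i) (W j) := by
    have e : n * (Real.exp ((∑ i, Real.log (W i)) / n
        - (∑ i, ∑ j, |Real.log (W i) - Real.log (W j)|) / (2 * n ^ 2)) / ((∑ i, W i) / n))
          * ∑ i, W i
        = n ^ 2 * Real.exp ((∑ i, Real.log (W i)) / n
            - (∑ i, ∑ j, |Real.log (W i) - Real.log (W j)|) / (2 * n ^ 2)) := by
      field_simp
    rw [e]
    have := mul_le_mul_of_nonneg_left hJ (pow_pos hn 2).le
    rwa [mul_div_cancel₀ _ (pow_pos hn 2).ne'] at this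
  nlinarith [hkey, hn1, hS]

end Batch

end Summit.Ventures.LatticeQCDFlow.Scoring
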